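import Mathlib.MeasureTheory.Integral.Lebesgue.Add
import Mathlib.MeasureTheory.Integral.Lebesgue.Markov
import Mathlib.MeasureTheory.Integral.Bochner.Basic
import HarnessLib

/-!
# Abstract good-set / bad-set bookkeeping for the locality estimate

Helper file (`--supports stmt-AtomisticToContinuum-12240`, item `HalfChainLocality` of route
`BoundaryEscapeDeficit`, sub-problem `FouriersLaw`). Pure measure theory, no chains: on a measure space
`(Ω, π)` let `a, p, p'` be measurable real functions and `G` a measurable set on which `|p - p'| ≤ ε`.
For the "boundary autocorrelation integrands" `Y = a (p² - T)`, `Y' = a (p'² - T)`: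

* on `G`: `|Y - Y'| = |a| |p - p'| |p + p'| ≤ ε (a² + (p² + p'²)/2)`;
* off `G`: `|Y - Y'| ≤ |Y| + |Y'| ≤ λ (Y² + Y'²)/2 + 1/λ` for every `λ > 0` (AM–GM, no Hölder needed);

hence (`lintegral_abs_sub_le_of_good_set`, **main**)

  `∫ |Y - Y'| dπ ≤ ε (∫ a² + ½ ∫ p² + ½ ∫ p'²) + (λ/2)(∫ Y² + ∫ Y'²) + π(Gᶜ)/λ`

as an inequality of `ℝ≥0∞`-valued Lebesgue integrals (no integrability side conditions). Folklore; no
definitions.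
-/

noncomputable section

open MeasureTheory Set
open scoped ENNReal

namespace Summit.AtomisticToContinuum.FouriersLaw.Theorems.HalfChainLocality

variable {Ω : Type*} [MeasurableSpace Ω] {π : Measure Ω}

/-- AM–GM in the form `|y| ≤ (λ y² + λ⁻¹)/2` (`λ > 0`). [folklore] -/
theorem abs_le_half_mul_sq_add_inv {lam : ℝ} (hlam : 0 < lam) (y : ℝ) : |y| ≤ (lam * y ^ 2 + lam⁻¹) / 2 := by
  have h : 0 ≤ (lam * |y| - 1) ^ 2 := sq_nonneg _
  have key : lam * y ^ 2 + lam⁻¹ - 2 * |y| = lam⁻¹ * (lam * |y| - 1) ^ 2 := by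
    rw [← sq_abs y]
    field_simp
    ring
  have : 0 ≤ lam * y ^ 2 + lam⁻¹ - 2 * |y| := by
    rw [key]; exact mul_nonneg (inv_pos.2 hlam).le h
  linarith

/-- The pointwise good-set bound: if `|p - p'| ≤ ε` then
`|a (p² - T) - a (p'² - T)| ≤ ε (a² + (p² + p'²)/2)`. [folklore] -/
theorem abs_obs_sub_le_on_good {a p p' T ε : ℝ} (hε : 0 ≤ ε) (h : |p - p'| ≤ ε) :
    |a * (p ^ 2 - T) - a * (p' ^ 2 - T)| ≤ ε * (a ^ 2 + (p ^ 2 + p' ^ 2) / 2) := by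
  have e : a * (p ^ 2 - T) - a * (p' ^ 2 - T) = a * (p - p') * (p + p') := by ring
  rw [e, abs_mul, abs_mul]
  have h1 : |a| * |p + p'| ≤ a ^ 2 + (p ^ 2 + p' ^ 2) / 2 := by
    have := abs_add_le p p'
    nlinarith [abs_nonneg a, abs_nonneg p, abs_nonneg p', abs_nonneg (p + p'), sq_abs a, sq_abs p, sq_abs p',
      sq_nonneg (|a| - |p|), sq_nonneg (|a| - |p'|)]
  calc |a| * |p - p'| * |p + p'| = |p - p'| * (|a| * |p + p'|) := by ring
    _ ≤ ε * (a ^ 2 + (p ^ 2 + p' ^ 2) / 2) :=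
        mul_le_mul h h1 (mul_nonneg (abs_nonneg _) (abs_nonneg _)) hε

/-- The pointwise bad-set bound: `|Y - Y'| ≤ λ (Y² + Y'²)/2 + λ⁻¹` for every `λ > 0`. [folklore] -/
theorem abs_sub_le_on_bad {lam : ℝ} (hlam : 0 < lam) (Y Y' : ℝ) :
    |Y - Y'| ≤ lam / 2 * (Y ^ 2 + Y' ^ 2) + lam⁻¹ := by
  have h1 := abs_le_half_mul_sq_add_inv hlam Y
  have h2 := abs_le_half_mul_sq_add_inv hlam Y'
  calc |Y - Y'| ≤ |Y| + |Y'| := abs_sub Y Y'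
    _ ≤ (lam * Y ^ 2 + lam⁻¹) / 2 + (lam * Y' ^ 2 + lam⁻¹) / 2 := add_le_add h1 h2
    _ = lam / 2 * (Y ^ 2 + Y' ^ 2) + lam⁻¹ := by ring

/-- **Good-set / bad-set bookkeeping for `∫ |a(p²-T) - a(p'²-T)|`.** For measurable real `a, p, p'`, a
measurable set `G` with `|p - p'| ≤ ε` on `G` (`ε ≥ 0`) and any `λ > 0`:
`∫ |Y - Y'| ≤ ε (∫ a² + ½∫ p² + ½∫ p'²) + (λ/2)(∫ Y² + ∫ Y'²) + λ⁻¹ π(Gᶜ)`,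
`Y = a(p²-T)`, `Y' = a(p'²-T)`, all integrals being `ℝ≥0∞`-valued Lebesgue integrals of `ofReal`s.
[folklore] -/
theorem lintegral_abs_sub_le_of_good_set {a p p' : Ω → ℝ} (ha : Measurable a) (hp : Measurable p)
    (hp' : Measurable p') {G : Set Ω} (hG : MeasurableSet G) {T ε lam : ℝ} (hε : 0 ≤ ε) (hlam : 0 < lam)
    (hgood : ∀ x ∈ G, |p x - p' x| ≤ ε) :
    ∫⁻ x, ENNReal.ofReal |a x * (p x ^ 2 - T) - a x * (p' x ^ 2 - T)| ∂π ≤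
      ENNReal.ofReal ε * (∫⁻ x, ENNReal.ofReal (a x ^ 2) ∂π +
        ENNReal.ofReal (1 / 2) * ∫⁻ x, ENNReal.ofReal (p x ^ 2) ∂π +
        ENNReal.ofReal (1 / 2) * ∫⁻ x, ENNReal.ofReal (p' x ^ 2) ∂π) +
      ENNReal.ofReal (lam / 2) * (∫⁻ x, ENNReal.ofReal ((a x * (p x ^ 2 - T)) ^ 2) ∂π +
        ∫⁻ x, ENNReal.ofReal ((a x * (p' x ^ 2 - T)) ^ 2) ∂π) +
      ENNReal.ofReal lam⁻¹ * π Gᶜ := by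
  -- pointwise bound by `1_G · good + 1_{Gᶜ} · bad`
  set good : Ω → ℝ≥0∞ := fun x => ENNReal.ofReal ε * (ENNReal.ofReal (a x ^ 2) +
      ENNReal.ofReal (1 / 2) * ENNReal.ofReal (p x ^ 2) + ENNReal.ofReal (1 / 2) * ENNReal.ofReal (p' x ^ 2))
    with hgood_def
  set bad : Ω → ℝ≥0∞ := fun x => ENNReal.ofReal (lam / 2) * (ENNReal.ofReal ((a x * (p x ^ 2 - T)) ^ 2) +
      ENNReal.ofReal ((a x * (p' x ^ 2 - T)) ^ 2)) + ENNReal.ofReal lam⁻¹ with hbad_def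
  have hptw : ∀ x, ENNReal.ofReal |a x * (p x ^ 2 - T) - a x * (p' x ^ 2 - T)| ≤
      G.indicator good x + Gᶜ.indicator bad x := by
    intro x
    by_cases hx : x ∈ G
    · rw [indicator_of_mem hx, indicator_of_notMem (Set.notMem_compl_iff.2 hx), add_zero, hgood_def]
      dsimp only
      have h := abs_obs_sub_le_on_good (a := a x) (T := T) hε (hgood x hx)
      refine (ENNReal.ofReal_le_ofReal h).trans (le_of_eq ?_)
      have h0 : 0 ≤ a x ^ 2 := sq_nonneg _
      have h1 : 0 ≤ p x ^ 2 := sq_nonneg _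
      have h2 : 0 ≤ p' x ^ 2 := sq_nonneg _
      rw [ENNReal.ofReal_mul hε, ← ENNReal.ofReal_mul (by norm_num : (0:ℝ) ≤ 1 / 2),
        ← ENNReal.ofReal_mul (by norm_num : (0:ℝ) ≤ 1 / 2), ← ENNReal.ofReal_add h0 (by positivity),
        ← ENNReal.ofReal_add (by positivity) (by positivity)]
      congr 1
      ring
    · rw [indicator_of_notMem hx, indicator_of_mem (mem_compl hx), zero_add, hbad_def]
      dsimp only
      have h := abs_sub_le_on_bad hlam (a x * (p x ^ 2 - T)) (a x * (p' x ^ 2 - T))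
      refine (ENNReal.ofReal_le_ofReal h).trans (le_of_eq ?_)
      rw [ENNReal.ofReal_add (by positivity) (inv_pos.2 hlam).le, ENNReal.ofReal_mul (by positivity),
        ENNReal.ofReal_add (sq_nonneg _) (sq_nonneg _)]
  -- measurability
  have hmY : Measurable fun x => ENNReal.ofReal ((a x * (p x ^ 2 - T)) ^ 2) :=
    ((ha.mul ((hp.pow_const 2).sub_const T)).pow_const 2).ennreal_ofReal
  have hmY' : Measurable fun x => ENNReal.ofReal ((a x * (p' x ^ 2 - T)) ^ 2) :=
    ((ha.mul ((hp'.pow_const 2).sub_const T)).pow_const 2).ennreal_ofReal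
  have hma : Measurable fun x => ENNReal.ofReal (a x ^ 2) := (ha.pow_const 2).ennreal_ofReal
  have hmp : Measurable fun x => ENNReal.ofReal (p x ^ 2) := (hp.pow_const 2).ennreal_ofReal
  have hmp' : Measurable fun x => ENNReal.ofReal (p' x ^ 2) := (hp'.pow_const 2).ennreal_ofReal
  have hm2 : Measurable fun x => ENNReal.ofReal (a x ^ 2) + ENNReal.ofReal (1 / 2) * ENNReal.ofReal (p x ^ 2) :=
    hma.add (hmp.const_mul _)
  have hm3 : Measurable fun x => ENNReal.ofReal (a x ^ 2) + ENNReal.ofReal (1 / 2) * ENNReal.ofReal (p x ^ 2) +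
      ENNReal.ofReal (1 / 2) * ENNReal.ofReal (p' x ^ 2) := hm2.add (hmp'.const_mul _)
  have hmYY : Measurable fun x => ENNReal.ofReal ((a x * (p x ^ 2 - T)) ^ 2) +
      ENNReal.ofReal ((a x * (p' x ^ 2 - T)) ^ 2) := hmY.add hmY'
  have hmgood : Measurable good := hm3.const_mul _
  have hmbad : Measurable bad := (hmYY.const_mul _).add measurable_const
  -- the two integrals
  have hgood_int : ∫⁻ x, good x ∂π = ENNReal.ofReal ε * (∫⁻ x, ENNReal.ofReal (a x ^ 2) ∂π +
      ENNReal.ofReal (1 / 2) * ∫⁻ x, ENNReal.ofReal (p x ^ 2) ∂π +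
      ENNReal.ofReal (1 / 2) * ∫⁻ x, ENNReal.ofReal (p' x ^ 2) ∂π) := by
    simp only [hgood_def]
    rw [lintegral_const_mul _ hm3, lintegral_add_left hm2, lintegral_add_left hma,
      lintegral_const_mul _ hmp, lintegral_const_mul _ hmp']
  have hbad_int : ∫⁻ x in Gᶜ, bad x ∂π ≤
      ENNReal.ofReal (lam / 2) * (∫⁻ x, ENNReal.ofReal ((a x * (p x ^ 2 - T)) ^ 2) ∂π +
        ∫⁻ x, ENNReal.ofReal ((a x * (p' x ^ 2 - T)) ^ 2) ∂π) + ENNReal.ofReal lam⁻¹ * π Gᶜ := by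
    simp only [hbad_def]
    rw [lintegral_add_right _ measurable_const, setLIntegral_const]
    refine add_le_add ?_ le_rfl
    calc ∫⁻ x in Gᶜ, ENNReal.ofReal (lam / 2) * (ENNReal.ofReal ((a x * (p x ^ 2 - T)) ^ 2) +
          ENNReal.ofReal ((a x * (p' x ^ 2 - T)) ^ 2)) ∂π
        ≤ ∫⁻ x, ENNReal.ofReal (lam / 2) * (ENNReal.ofReal ((a x * (p x ^ 2 - T)) ^ 2) +
          ENNReal.ofReal ((a x * (p' x ^ 2 - T)) ^ 2)) ∂π := lintegral_mono' Measure.restrict_le_self le_rfl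
      _ = _ := by rw [lintegral_const_mul _ hmYY, lintegral_add_left hmY]
  -- integrate
  calc ∫⁻ x, ENNReal.ofReal |a x * (p x ^ 2 - T) - a x * (p' x ^ 2 - T)| ∂π
      ≤ ∫⁻ x, G.indicator good x + Gᶜ.indicator bad x ∂π := lintegral_mono hptw
    _ = ∫⁻ x, G.indicator good x ∂π + ∫⁻ x, Gᶜ.indicator bad x ∂π :=
        lintegral_add_left (hmgood.indicator hG) _
    _ ≤ ∫⁻ x, good x ∂π + ∫⁻ x in Gᶜ, bad x ∂π := by
        refine add_le_add (lintegral_mono fun x => indicator_le_self _ _ x) (le_of_eq ?_)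
        exact lintegral_indicator hG.compl _
    _ ≤ _ := by
        rw [hgood_int]
        calc _ ≤ _ := add_le_add le_rfl hbad_int
          _ = _ := (add_assoc _ _ _).symm

end Summit.AtomisticToContinuum.FouriersLaw.Theorems.HalfChainLocality

end
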